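import Literature.MathematicalPhysics.QuantumLattice.AnisotropicKLSIntegralBound
import Literature.Probability.LatticeModels.AnisotropicInfraredConstantBound
import HarnessLib

/-!
# The layered quantum XY / hard-core-boson model: an EXPLICIT low-temperature threshold
# `β₀(r) = A_n + B_n·log(1/r)` for long-range order at interlayer coupling `0 < r ≤ 1`

Topic `MathematicalPhysics/QuantumLattice`; makes the positive-temperature theorem
`xyAniso_longRangeOrder_thermal_of_integral` (`AnisotropicKLSIntegral.lean`, `∃ β₀`) QUANTITATIVE
for the layered couplings `K = (1, 1, r)` of [KLS1988JSP] §3, now that the integral hypothesis is a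
theorem (`anisoKlsIntegral_layered_lt`, `AnisotropicKLSIntegralBound.lean`):

* `anisoKls_margin_thermal_explicit` — the abstract endgame of `AnisotropicKLSMargin.lean` with the
  threshold `β₀ = 1 + 2ℓ/s + 2(2ℓ + 𝒯)/c`, `c = 2(s - ½√s ρ₊)`, in the STATEMENT (the tree's
  `anisoKls_margin_thermal` proves exactly this but concludes `∃ β₀`);
* `anisoKlsThermalSum_le_torusInvSum` — the thermal companion `J^K_L ≤ L^{-d}Σ_{k≠0} 1/E^K_k`
  (`{C_K}₊ ≤ κ_K`; no division by `min K`, unlike `anisoKlsThermalSum_le_torusGreen_div`), so that for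
  `K = (1,1,r)` the torus sum tends to Fröhlich–Israel–Lieb–Simon's constant
  `C(r) = (2π)⁻³∫d³q/E^r_q = klsConstant r ≤ 3 + log(1/r)` (the tree's
  `torusSum_inv_anisoDispersion_approx`, `infraredConstant_layeredCoupling`, `klsConstant_le`) —
  the interlayer LOGARITHM enters the quantum threshold exactly as in the classical floor
  `layered_longRangeOrder_explicit`;
* `xyLayered_longRangeOrder_thermal_explicit` — for `0 < r ≤ 1`, spin `S = n/2 ≥ ½` and every
  `β ≥ 1 + 2ℓ/s + 2(2ℓ + 4 + log(1/r))/c` with `s = n²/8`, `ℓ = log(n+1)/(2(2+r))`,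
  `c = 2(s - ½√s·(869/1250))` (`ρ = 0.6952 ≥` the bound `√2/4 + (3823/5040)√2/π = 0.69502` of
  `anisoKlsIntegral_two_le`), the Gibbs states of `H_{(1,1,r)}` on the even tori have long-range
  order; numerically (not asserted in Lean): `S = ½`: `βJ∥ ≥ 2100 + 475·log(J∥/J⊥)` suffices;
  `S = 1`: `βJ∥ ≥ 22 + 4·log(J∥/J⊥)`; compare the classical rotor floor `βJ∥ > 3 + log(J∥/J⊥)`
  (`layered_longRangeOrder_explicit`). The `S = ½` constant is large because the KLS margin
  `√2/2 - I` is `0.012`; nothing sharper is claimed.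

No named fact; no statement of the tree is changed.

## References

* [KLS1988JSP] T. Kennedy, E. H. Lieb, B. S. Shastry, J. Stat. Phys. 53 (1988) 1019–1030, §3 and
  p. 1020 (positive temperature by the methods of Dyson–Lieb–Simon).
* [KLS1988PRL] T. Kennedy, E. H. Lieb, B. S. Shastry, Phys. Rev. Lett. 61 (1988) 2582–2584, eq. (7)
  and the paragraph after eq. (8).
* [DLS1978] F. J. Dyson, E. H. Lieb, B. Simon, J. Stat. Phys. 18 (1978) 335–383, Thm. 5.1.
* [FILS1978] J. Fröhlich, R. Israel, E. H. Lieb, B. Simon, Commun. Math. Phys. 62 (1978) 1–34, (4.7).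
-/

noncomputable section

open Filter Topology Finset
open Literature.MathematicalPhysics.QuantumLattice Literature.Probability.LatticeModels
  Literature.MathematicalPhysics.QuantumLattice.XYOrderProofs

namespace Literature.MathematicalPhysics.QuantumLattice

variable {d : ℕ}

/-! ### The abstract margin with the threshold in the statement -/

/-- **The low-temperature margin with an explicit threshold** (the tree's `anisoKls_margin_thermal`,
`β₀ = 1 + 2ℓ/s + 2(2ℓ + 𝒯)/c`, `c = 2(s - ½√sρ₊)`, moved into the statement): `s > 0`, `ℓ, 𝒯 ≥ 0`,
`ρ < 2√s`, `0 ≤ R_k ≤ ρ` and `T_k ≤ 𝒯` eventually; then for every `β ≥ β₀` every real sequence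
`a ≤ M` with, eventually, `a_k = 2g_k`, `e_k ≤ g_k + ½√e_k R_k + T_k/(2β)`, `e_k ≥ s - ℓ/β`, has
`liminf a ≥ s - ½√sρ₊ > 0`. [cite: KLS1988PRL, Theorem and eqs. (7)–(8)] [cite: DysonLiebSimon1978, Thm. 5.1] -/
theorem anisoKls_margin_thermal_explicit {s ℓ ρ 𝒯 : ℝ} (hs : 0 < s) (hℓ : 0 ≤ ℓ)
    (hρ : ρ < 2 * Real.sqrt s) (h𝒯 : 0 ≤ 𝒯) {R T : ℕ → ℝ} (hR0 : ∀ k, 0 ≤ R k)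
    (hRρ : ∀ᶠ k : ℕ in atTop, R k ≤ ρ) (hT𝒯 : ∀ᶠ k : ℕ in atTop, T k ≤ 𝒯) {β : ℝ}
    (hβ : 1 + 2 * ℓ / s + 2 * (2 * ℓ + 𝒯) / (2 * (s - 1 / 2 * Real.sqrt s * max ρ 0)) ≤ β)
    (M : ℝ) (a : ℕ → ℝ) (hbd : ∀ k, a k ≤ M)
    (hev : ∀ᶠ k : ℕ in atTop, ∃ e g : ℝ, a k = 2 * g ∧
      e ≤ g + 1 / 2 * Real.sqrt e * R k + 1 / (2 * β) * T k ∧ s - ℓ / β ≤ e) :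
    s - 1 / 2 * Real.sqrt s * max ρ 0 ≤ liminf a atTop ∧
      0 < s - 1 / 2 * Real.sqrt s * max ρ 0 := by
  set ρ' : ℝ := max ρ 0 with hρ'_def
  have hρ'0 : 0 ≤ ρ' := le_max_right _ _
  have hρ'lt : ρ' < 2 * Real.sqrt s := max_lt hρ (by positivity)
  set c : ℝ := 2 * (s - 1 / 2 * Real.sqrt s * ρ') with hc_def
  have hc : 0 < c := anisoKls_margin_pos hs hρ
  have hβ₀pos : 0 < 1 + 2 * ℓ / s + 2 * (2 * ℓ + 𝒯) / c := by positivity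
  refine ⟨?_, by linarith⟩
  have hβpos : 0 < β := hβ₀pos.trans_le hβ
  have hβ1 : 2 * ℓ / s ≤ β := by
    have : (0 : ℝ) ≤ 2 * (2 * ℓ + 𝒯) / c := by positivity
    linarith
  have hβ2 : 2 * (2 * ℓ + 𝒯) / c ≤ β := by
    have : (0 : ℝ) ≤ 2 * ℓ / s := by positivity
    linarith
  have hℓβ : ℓ / β ≤ s / 2 := by
    rw [div_le_iff₀ hβpos]
    rw [div_le_iff₀ hs] at hβ1
    linarith
  have hτβ : (2 * ℓ + 𝒯) / β ≤ c / 2 := by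
    rw [div_le_iff₀ hβpos]
    rw [div_le_iff₀ hc] at hβ2
    linarith
  have hRk : ∀ᶠ k : ℕ in atTop, R k ≤ ρ' := hRρ.mono fun k hk => hk.trans (le_max_left _ _)
  have hev' : ∀ᶠ k : ℕ in atTop, c / 2 ≤ a k := by
    filter_upwards [hRk, hT𝒯, hev] with k hk hTk hevk
    obtain ⟨e, g, hag, h7, hDk⟩ := hevk
    obtain ⟨sβ, hsβ_def⟩ : ∃ sβ : ℝ, sβ = s - ℓ / β := ⟨_, rfl⟩
    have hℓβ0 : 0 ≤ ℓ / β := by positivity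
    have hsβe : sβ ≤ e := by rw [hsβ_def]; exact hDk
    have hsβs : sβ ≤ s := by rw [hsβ_def]; linarith
    have hsβ2 : s / 2 ≤ sβ := by rw [hsβ_def]; linarith
    have hsβ0 : 0 ≤ sβ := by linarith
    have hR4 : R k ≤ 4 * Real.sqrt sβ := by
      have h1 : Real.sqrt s ≤ Real.sqrt (4 * sβ) := Real.sqrt_le_sqrt (by linarith)
      rw [Real.sqrt_mul (by norm_num : (0 : ℝ) ≤ 4),
        show Real.sqrt 4 = 2 by
          rw [show (4 : ℝ) = 2 ^ 2 by norm_num, Real.sqrt_sq (by norm_num)]] at h1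
      linarith
    have hmono := kls_monotone_step hsβ0 hsβe hR4
    have hRs : 1 / 2 * Real.sqrt sβ * R k ≤ 1 / 2 * Real.sqrt s * ρ' :=
      mul_le_mul (mul_le_mul_of_nonneg_left (Real.sqrt_le_sqrt hsβs) (by norm_num)) hk (hR0 k)
        (by positivity)
    have hTβ : 1 / (2 * β) * T k ≤ 𝒯 / (2 * β) := by
      rw [one_div_mul_eq_div]
      exact div_le_div_of_nonneg_right hTk (by positivity)
    have key : sβ - 1 / 2 * Real.sqrt sβ * R k - 1 / (2 * β) * T k ≤ g := by
      linarith [h7, hmono]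
    have hsplit : (2 * ℓ + 𝒯) / β = 2 * (ℓ / β) + 2 * (𝒯 / (2 * β)) := by
      field_simp
    rw [hag]
    linarith [key, hRs, hTβ, hτβ, hsβ_def, hc_def, hsplit]
  have hlim : c / 2 ≤ liminf a atTop :=
    le_liminf_of_le (isCoboundedUnder_ge_of_le atTop hbd) hev'
  have : c / 2 = s - 1 / 2 * Real.sqrt s * ρ' := by rw [hc_def]; ring
  linarith

/-! ### The thermal companion through the torus sum of `1/E^K` -/

/-- **`J^K_L ≤ L^{-d} Σ_{k ≠ 0} 1/E^K_{2πk/L}`** for `K > 0` (`{C_K}₊ ≤ κ_K`).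
[cite: DysonLiebSimon1978, Thm. 5.1] [cite: KLS1988JSP, p. 1020] -/
theorem anisoKlsThermalSum_le_torusInvSum (hd : 1 ≤ d) (L : ℕ) [NeZero L] {K : Fin d → ℝ}
    (hK : ∀ i, 0 < K i) :
    anisoKlsThermalSum K L ≤
      1 / (L : ℝ) ^ d * ∑ k ∈ (univ : Finset (TorusSite d L)).erase 0,
        1 / NVectorAniso.anisoDispersion K (latticeMomentum L k) := by
  have hκ : 0 < ∑ i, K i := by
    obtain ⟨i⟩ : Nonempty (Fin d) := ⟨⟨0, hd⟩⟩
    exact lt_of_lt_of_le (hK i) (single_le_sum (fun j _ => (hK j).le) (mem_univ i))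
  rw [anisoKlsThermalSum_of_neZero, one_div_mul_eq_div]
  refine div_le_div_of_nonneg_right (sum_le_sum fun q hq => ?_) (by positivity)
  have hq0 : q ≠ 0 := (mem_erase.1 hq).1
  have hEK : 0 < NVectorAniso.anisoDispersion K (latticeMomentum L q) :=
    anisoDispersion_latticeMomentum_pos L hK hq0
  calc max (anisoCosSum K (latticeMomentum L q)) 0 /
        ((∑ i, K i) * NVectorAniso.anisoDispersion K (latticeMomentum L q))
      ≤ (∑ i, K i) / ((∑ i, K i) * NVectorAniso.anisoDispersion K (latticeMomentum L q)) :=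
        div_le_div_of_nonneg_right (max_le (anisoCosSum_le (fun i => (hK i).le) _) hκ.le)
          (by positivity)
    _ = 1 / NVectorAniso.anisoDispersion K (latticeMomentum L q) := by
        field_simp

/-- The layered coupling vector of the classical files is `(1, 1, r)`. [cite: KLS1988JSP, eq. (5)] -/
theorem layeredCoupling_one_eq (r : ℝ) :
    AnisotropicRotator.layeredCoupling 1 r = ![(1 : ℝ), 1, r] := by
  funext i
  fin_cases i <;> simp [AnisotropicRotator.layeredCoupling]

/-- **The thermal companion of the layered couplings is eventually below `4 + log(1/r)`**
(`0 < r ≤ 1`), along the even sides: `J^{(1,1,r)}_{2k} ≤ L^{-3}Σ 1/E^r → C(r) ≤ 3 + log(1/r)`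
(FILS's constant; the tree's `torusSum_inv_anisoDispersion_approx`, `infraredConstant_layeredCoupling`,
`klsConstant_le`). [cite: KLS1988JSP, eq. (7) and p. 1020] [cite: FILS1978, eq. (4.7)] -/
theorem anisoKlsThermalSum_layered_eventually_le {r : ℝ} (hr : 0 < r) (hr1 : r ≤ 1) :
    ∀ᶠ k : ℕ in atTop, anisoKlsThermalSum ![(1 : ℝ), 1, r] (2 * k) ≤ 4 + Real.log (1 / r) := by
  have hK : ∀ i, 0 < (![(1 : ℝ), 1, r]) i := by
    intro i; fin_cases i <;> simp [hr]
  have hmK : ∀ i, r ≤ (![(1 : ℝ), 1, r]) i := by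
    intro i; fin_cases i <;> simp [hr1]
  obtain ⟨L₀, hL₀⟩ := AnisotropicRotator.torusSum_inv_anisoDispersion_approx (d := 3) le_rfl hr hmK
    (ε := 1) one_pos
  have hC : AnisotropicRotator.infraredConstant ![(1 : ℝ), 1, r] =
      AnisotropicRotator.klsConstant r := by
    rw [← layeredCoupling_one_eq, AnisotropicRotator.infraredConstant_layeredCoupling one_ne_zero,
      div_one, div_one]
  have hCle := AnisotropicRotator.klsConstant_le hr hr1
  filter_upwards [eventually_ge_atTop (L₀ + 1)] with k hk
  haveI : NeZero (2 * k) := ⟨by omega⟩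
  have h := hL₀ (2 * k) (even_two_mul k) (by omega)
  rw [abs_le, hC] at h
  have hJ := anisoKlsThermalSum_le_torusInvSum (d := 3) (by norm_num) (2 * k) hK
  have hcast : ((2 * k : ℕ) : ℝ) = (2 * k : ℕ) := rfl
  linarith [h.2]

/-! ### The explicit layered theorem -/

/-- **Long-range order of the layered quantum XY / hard-core-boson model below an explicit
temperature.** For `0 < r ≤ 1`, spin `S = n/2 ≥ ½`, and every
`β ≥ 1 + 2ℓ/s + 2(2ℓ + 4 + log(1/r))/c`, `s = n²/8` (`= ((n/2)²)/2`), `ℓ = log(n+1)/(2(2+r))`,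
`c = 2(s - ½√s·(869/1250))`, the Gibbs states of `H_{(1,1,r)} = -Σ_x[Σ_{i=1,2}(S¹S¹+S²S²) + r(S¹S¹+S²S²)_{vertical}]`
on the even tori `(ℤ/2kℤ)³` have long-range order. Inputs: eq. (7) at `β > 0`
(`xyAniso_kls_ineq7_thermal`), the energy–entropy bound (`xyAniso_weightedBondCorr_lower_thermal`),
`R_L → I_{(1,1,r)} ≤ 0.69502 < 0.6952` (`anisoKlsIntegral_layered_le_two`, `anisoKlsIntegral_two_le`,
`anisoKlsRiemannSum_eventually_le`) and `J_L ≤ 4 + log(1/r)` eventually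
(`anisoKlsThermalSum_layered_eventually_le`). Numerically `S = ½`: `β ≥ 2100 + 475 log(1/r)`
suffices; `S = 1`: `β ≥ 22 + 4 log(1/r)` [arith, not asserted].
[cite: KLS1988JSP, §3 and p. 1020] [cite: KLS1988PRL, Theorem] [cite: DysonLiebSimon1978, Thms. 5.1, 5.2] -/
theorem xyLayered_longRangeOrder_thermal_explicit {r : ℝ} (hr : 0 < r) (hr1 : r ≤ 1) {n : ℕ}
    (hn : 1 ≤ n) {β : ℝ}
    (hβ : 1 + 2 * (Real.log ((n : ℝ) + 1) / (2 * (2 + r))) / (((n : ℝ) / 2) ^ 2 / 2) +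
        2 * (2 * (Real.log ((n : ℝ) + 1) / (2 * (2 + r))) + (4 + Real.log (1 / r))) /
          (2 * (((n : ℝ) / 2) ^ 2 / 2 -
            1 / 2 * Real.sqrt (((n : ℝ) / 2) ^ 2 / 2) * max (869 / 1250 : ℝ) 0)) ≤ β) :
    HasEvenTorusLRO (fun L x y => xyAnisoThermalCorr β ![(1 : ℝ), 1, r] L n x y) := by
  set K : Fin 3 → ℝ := ![(1 : ℝ), 1, r] with hK_def
  have hK : ∀ i, 0 < K i := by
    intro i; fin_cases i <;> simp [hK_def, hr]
  set s : ℝ := ((n : ℝ) / 2) ^ 2 / 2 with hs_def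
  set κ : ℝ := ∑ i, K i with hκ_def
  have hκ2 : κ = 2 + r := by simp [hκ_def, hK_def, Fin.sum_univ_three]; ring
  have hn1 : (1 : ℝ) ≤ n := by exact_mod_cast hn
  have hs : 0 < s := by positivity
  have hκ : 0 < κ := by rw [hκ2]; linarith
  -- the Riemann-sum hypothesis with ρ = 0.6952
  set ρ : ℝ := 869 / 1250 with hρ_def
  have hIle' : anisoKlsIntegral K ≤ 6951 / 10000 := by
    have h1 := anisoKlsIntegral_layered_le_two hr.le (by linarith : r ≤ 2)
    have h2 := anisoKlsIntegral_two_le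
    have hs2 : Real.sqrt 2 < 1.41422 := by
      rw [Real.sqrt_lt' (by norm_num)]; norm_num
    have hπ : 1 / Real.pi < 0.31831 := by
      rw [div_lt_iff₀ Real.pi_pos]; nlinarith [Real.pi_gt_d6]
    have hs0 : 0 ≤ Real.sqrt 2 := Real.sqrt_nonneg 2
    have e : Real.sqrt 2 / 4 + 3823 / 5040 * Real.sqrt 2 / Real.pi =
        Real.sqrt 2 * (1 / 4 + 3823 / 5040 * (1 / Real.pi)) := by ring
    rw [e] at h2
    have h3 : Real.sqrt 2 * (1 / 4 + 3823 / 5040 * (1 / Real.pi)) ≤ 6951 / 10000 := by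
      nlinarith [hs2, hπ, hs0, Real.pi_pos, one_div_pos.2 Real.pi_pos]
    have h4 : anisoKlsIntegral ![(1 : ℝ), 1, r] ≤ 6951 / 10000 := h1.trans (h2.trans h3)
    simpa [hK_def] using h4
  have hsqrt : 2 * Real.sqrt s = n * Real.sqrt 2 / 2 := by
    have h2 : Real.sqrt 2 ^ 2 = 2 := Real.sq_sqrt (by norm_num : (0:ℝ) ≤ 2)
    have e : s = ((n : ℝ) * Real.sqrt 2 / 4) ^ 2 := by
      rw [hs_def]
      nlinarith [h2]
    rw [e, Real.sqrt_sq (by positivity)]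
    ring
  have hρlt : ρ < 2 * Real.sqrt s := by
    rw [hsqrt]
    have hs2 : (1.4142 : ℝ) < Real.sqrt 2 := by
      rw [Real.lt_sqrt (by norm_num)]; norm_num
    rw [hρ_def]; nlinarith
  have hIlt : anisoKlsIntegral K < ρ := lt_of_le_of_lt hIle' (by rw [hρ_def]; norm_num)
  have hmid : (anisoKlsIntegral K + ρ) / 2 ≤ ρ := by linarith [hIlt]
  have hR : ∀ᶠ k : ℕ in atTop, anisoKlsRiemannSum K (2 * k) ≤ ρ :=
    (anisoKlsRiemannSum_eventually_le (d := 3) le_rfl hK hIlt).mono fun k hk => hk.trans hmid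
  -- the thermal hypothesis
  have hJ : ∀ᶠ k : ℕ in atTop, anisoKlsThermalSum K (2 * k) ≤ 4 + Real.log (1 / r) :=
    anisoKlsThermalSum_layered_eventually_le hr hr1
  have h𝒯 : 0 ≤ 4 + Real.log (1 / r) := by
    have : 0 ≤ Real.log (1 / r) := Real.log_nonneg (by rw [le_div_iff₀ hr]; linarith)
    linarith
  -- the energy–entropy constant
  set ℓ : ℝ := Real.log ((n : ℝ) + 1) / (2 * κ) with hℓ_def
  have hℓ : 0 ≤ ℓ := div_nonneg (Real.log_nonneg (by linarith)) (by positivity)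
  -- the threshold of the statement is the threshold of `anisoKls_margin_thermal_explicit`
  have hβ' : 1 + 2 * ℓ / s + 2 * (2 * ℓ + (4 + Real.log (1 / r))) /
      (2 * (s - 1 / 2 * Real.sqrt s * max ρ 0)) ≤ β := by
    rw [hℓ_def, hκ2, hs_def, hρ_def]; exact hβ
  have hβpos : 0 < β := by
    have hc : 0 < 2 * (s - 1 / 2 * Real.sqrt s * max ρ 0) := anisoKls_margin_pos hs hρlt
    have : 0 < 1 + 2 * ℓ / s + 2 * (2 * ℓ + (4 + Real.log (1 / r))) /
        (2 * (s - 1 / 2 * Real.sqrt s * max ρ 0)) := by positivity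
    linarith
  -- eq. (7), the energy–entropy bound and the order parameter along the even sides
  have hev : ∀ᶠ k : ℕ in atTop, ∃ e g : ℝ,
      (∑ x ∈ halfOpenBox 3 (2 * k), ∑ y ∈ halfOpenBox 3 (2 * k),
          torusPullback (fun L x y => xyAnisoThermalCorr β K L n x y) (2 * k) x y) /
          ((halfOpenBox 3 (2 * k)).card : ℝ) ^ 2 = 2 * g ∧
        e ≤ g + 1 / 2 * Real.sqrt e * anisoKlsRiemannSum K (2 * k) +
          1 / (2 * β) * anisoKlsThermalSum K (2 * k) ∧ s - ℓ / β ≤ e := by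
    filter_upwards [eventually_ge_atTop 2] with k hk2
    haveI : NeZero (2 * k) := ⟨by omega⟩
    refine ⟨(∑ i, K i * gibbsDirBondCorr β (xyAnisoTorus (2 * k) n K) 0 i) / κ,
      gibbsStructureFactor β (xyAnisoTorus (2 * k) n K) 0 0 / ((2 * k : ℕ) : ℝ) ^ 3,
      xyAniso_thermal_lroSeq_eq β n K k (by omega),
      xyAniso_kls_ineq7_thermal (by norm_num) (2 * k) n hK ⟨k, by ring⟩ (by omega) hβpos, ?_⟩
    have hκ0 : κ ≠ 0 := hκ.ne'
    have hβ0 : β ≠ 0 := hβpos.ne'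
    rw [le_div_iff₀ hκ, show (s - ℓ / β) * κ = ((n : ℝ) / 2) ^ 2 / 2 * κ -
      Real.log ((n : ℝ) + 1) / (2 * β) by rw [hs_def, hℓ_def]; field_simp]
    exact xyAniso_weightedBondCorr_lower_thermal (2 * k) n K (by omega) hβpos
  obtain ⟨hlim, hc⟩ := anisoKls_margin_thermal_explicit hs hℓ hρlt h𝒯
    (fun k => anisoKlsRiemannSum_nonneg K (2 * k)) hR hJ hβ' _ _
    (xyAniso_thermal_lroSeq_le β n K) hev
  exact (hasEvenTorusLRO_iff _).2 (hc.trans_le hlim)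

end Literature.MathematicalPhysics.QuantumLattice
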